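import Mathlib
import Summits.NavierStokesRegularity.NavierStokesRegularity.Theses.TypeILiouville
import Summits.NavierStokesRegularity.NavierStokesRegularity.Theorems.TypeIQuarterGateTypeIClockLiouvilleLinks
import Summits.NavierStokesRegularity.NavierStokesRegularity.Theorems.TypeIQuarterGateQuarterZoomEnstrophyClock
import Summits.NavierStokesRegularity.NavierStokesRegularity.Theorems.GaldiLiouvilleGateParabolicGaldiLiouvilleKnownCases
import HarnessLib

/-!
# `TypeIQuarterGate`: the re-typed residuals TQAL / LRL sit BELOW the KNSS Liouville conjecture (L)
# — by-name edges from item `TypeILiouville.TypeIliouvilleL` (stmt-NavierStokesRegularity-10661)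

Helper file for crux `ParabolicGaldiLiouville` (stmt-NavierStokesRegularity-0893) of route
`TypeIQuarterGate` (theorems only, no definitions). The KNSS Liouville conjecture (L), carried by the
tree as the route item `Theses.TypeILiouville.TypeIliouvilleL` (definitionally the conjecture leaf
`LiouvilleConjectureNS`), implies X2 (`parabolicGaldiLiouville_of_liouvilleConjectureNS`, landed), hence
the re-typed residuals of this route: TQAL (X2 + velocity Type-I clock) and LRL (X2 + velocity and
enstrophy clocks), both spelled inline as in `TypeIQuarterGateTypeIClockLiouvilleLinks` /
`TypeIQuarterGateQuarterZoomEnstrophyClock`.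

* `typeIClockLiouville_of_typeIliouvilleL` — item 10661 ⟹ TQAL.
* `lerayRateLiouville_of_typeIliouvilleL` — item 10661 ⟹ LRL.

So, by name: (L) = 10661 ⟹ X2 = 0893 ⟹ TQAL ⟹ LRL, and `QuarterLawTypeI ∧ NoTypeII ∧ LRL ⟹
NavierStokesRegularity` (`typeIQuarterGate_of_lerayRateLiouville`). HONEST FRAMING: implications
between OPEN statements; nothing here bears on Navier–Stokes regularity.
References: Koch–Nadirashvili–Seregin–Šverák, Acta Math. 203 (2009), §1.
-/

noncomputable section

set_option linter.dupNamespace false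

namespace Summit.NavierStokesRegularity.NavierStokesRegularity.Theorems

open Set MeasureTheory Filter Topology Function
open scoped ENNReal NNReal
open Literature.Analysis.FluidPDE

/-- **(L) ⟹ TQAL.** The route item `TypeILiouville.TypeIliouvilleL` (KNSS Liouville conjecture (L),
stmt-NavierStokesRegularity-10661) implies the Type-I-clock Liouville statement in Galdi's parabolic
class (via X2: `parabolicGaldiLiouville_of_liouvilleConjectureNS`, then drop the clock).
[cite: KochNadirashviliSereginSverak2009, §1] -/
theorem typeIClockLiouville_of_typeIliouvilleL
    (hL : Summit.NavierStokesRegularity.NavierStokesRegularity.Theses.TypeILiouville.TypeIliouvilleL) :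
    ∀ v : ℝ → EuclideanSpace ℝ (Fin 3) → EuclideanSpace ℝ (Fin 3),
      IsBoundedAncientMildSolution 1 v →
      ContDiffOn ℝ (⊤ : ℕ∞) (Function.uncurry v) (Set.Iio 0 ×ˢ Set.univ) →
      (∃ C : NNReal, ∀ s < 0,
        ∫⁻ y, ENNReal.ofReal (frobeniusNormSq (fderiv ℝ (v s) y)) ≤ C) →
      (∀ s < 0, MemLp (v s) 6 volume) →
      (∃ C' : ℝ, 0 ≤ C' ∧ ∀ s < 0, ∀ y, Real.sqrt (-s) * ‖v s y‖ ≤ C') →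
      ∀ s < 0, ∀ y, v s y = 0 := by
  have hLC : Summit.NavierStokesRegularity.NavierStokesRegularity.LiouvilleConjectureNS := hL
  have hX2 : Summit.NavierStokesRegularity.NavierStokesRegularity.Theses.TypeIQuarterGate.ParabolicGaldiLiouville :=
    ParabolicGaldiLiouville.Birth.parabolicGaldiLiouville_of_liouvilleConjectureNS hLC
  exact typeIClockLiouville_of_parabolicGaldiLiouville hX2

/-- **(L) ⟹ LRL.** The route item `TypeILiouville.TypeIliouvilleL` (stmt-NavierStokesRegularity-10661)
implies the Leray-rate Liouville statement (X2 + velocity clock + enstrophy clock) — the re-typed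
residual of `TypeIQuarterGate` (`typeIQuarterGate_of_lerayRateLiouville`).
[cite: KochNadirashviliSereginSverak2009, §1] -/
theorem lerayRateLiouville_of_typeIliouvilleL
    (hL : Summit.NavierStokesRegularity.NavierStokesRegularity.Theses.TypeILiouville.TypeIliouvilleL) :
    ∀ v : ℝ → EuclideanSpace ℝ (Fin 3) → EuclideanSpace ℝ (Fin 3),
      IsBoundedAncientMildSolution 1 v →
      ContDiffOn ℝ (⊤ : ℕ∞) (Function.uncurry v) (Set.Iio 0 ×ˢ Set.univ) →
      (∃ C : NNReal, ∀ s < 0,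
        ∫⁻ y, ENNReal.ofReal (frobeniusNormSq (fderiv ℝ (v s) y)) ≤ C) →
      (∀ s < 0, MemLp (v s) 6 volume) →
      (∃ C' : ℝ, 0 ≤ C' ∧ ∀ s < 0, ∀ y, Real.sqrt (-s) * ‖v s y‖ ≤ C') →
      (∃ K' : ℝ, 0 ≤ K' ∧ ∀ s < 0, ∫⁻ y, ENNReal.ofReal (frobeniusNormSq (fderiv ℝ (v s) y)) ≤
        ENNReal.ofReal (K' / Real.sqrt (-s))) →
      ∀ s < 0, ∀ y, v s y = 0 :=
  lerayRateLiouville_of_typeIClockLiouville (typeIClockLiouville_of_typeIliouvilleL hL)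

/-- **The route closes from `QuarterLawTypeI ∧ NoTypeII ∧ (L)` by name** (composition of
`typeIQuarterGate_of_lerayRateLiouville` with `lerayRateLiouville_of_typeIliouvilleL`); of course
`NoTypeII ∧ (L)` alone already suffice (route `TypeILiouville`), the point of this route being that (L)
is needed only in the weaker form LRL. [cite: KochNadirashviliSereginSverak2009, §1 and §6] -/
theorem typeIQuarterGate_of_typeIliouvilleL
    (hQ : Summit.NavierStokesRegularity.NavierStokesRegularity.Theses.TypeIQuarterGate.QuarterLawTypeI)
    (hII : Summit.NavierStokesRegularity.NavierStokesRegularity.Theses.TypeIQuarterGate.NoTypeII)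
    (hL : Summit.NavierStokesRegularity.NavierStokesRegularity.Theses.TypeILiouville.TypeIliouvilleL) :
    NavierStokesRegularity :=
  typeIQuarterGate_of_lerayRateLiouville hQ hII (lerayRateLiouville_of_typeIliouvilleL hL)

end Summit.NavierStokesRegularity.NavierStokesRegularity.Theorems

end
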